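import Literature.NumberTheory.Transcendental.ExpPointsExamples
import Literature.NumberTheory.Transcendental.GenericPointTranscendence
import Literature.NumberTheory.Transcendental.LindemannWeierstrassProofs
import HarnessLib

/-!
# Independent exponential points on `ℚ`-curves of `ℂ² × ℂ²`: degenerate sections

Let `W ⊆ ℂ² × ℂ²` be Zariski closed, defined over `ℚ` (`IsDefinedOver ⊥ W`) and of dimension
`< 2`, and let `indepExpPoints W = {x ∈ ℂ² | x ℚ-linearly independent, (x, eˣ) ∈ W}`
(`Literature.NumberTheory.Transcendental.indepExpPoints`). This file proves the first of the two
"classical classes" in the finiteness of `indepExpPoints W`: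

* `finite_indepExpPoints_section` — for `(a, b) ∈ ℤ² ∖ 0` and **any** `c ∈ ℂ`, only finitely many
  `x ∈ indepExpPoints W` lie on the degenerate section `a x₀ + b x₁ = c`.

Proof. If infinitely many did, their graph points would accumulate on an irreducible curve
`C = Z(P') ⊆ W ∩ {a x₀ + b x₁ = c}` (`exists_prime_infinite_inter_zeroLocus`). On `C` the
`ℚ`-linear form `a x₀ + b x₁` is the constant `c` and the monomial `y₀^a y₁^b` is the constant
`e^c`; a constant of an irreducible curve lying on a `ℚ`-variety of dimension `≤ 1` which is a
`ℚ`-rational function on the curve is algebraic (`mem_range_algebraMap_of_transcendental`, applied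
to the generic point of `C`), so `c` and `e^c` are algebraic, whence `c = 0` by Hermite–Lindemann
(`transcendental_exp_holds`) — but then `a x₀ + b x₁ = 0` makes every such `x` linearly dependent.

The file also records the shared preliminaries (the ideal over `ℚ` of a set defined over the
prime field, the generic-point packaging `isAlgebraic_of_rel_mem`, `exists_rat_poly_rename_mem`)
used by the companion file on the constant-exponential class.
-/

noncomputable section

open MvPolynomial Complex
open scoped Real

namespace Literature.NumberTheory.Transcendental

/-! ### Sets defined over the prime field are zero sets of ideals of `ℚ[X]` -/

/-- The bottom subfield of `ℂ` is the image of `ℚ`. [folklore] -/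
theorem exists_rat_eq_of_mem_bot {y : ℂ} (hy : y ∈ (⊥ : Subfield ℂ)) : ∃ q : ℚ, (q : ℂ) = y := by
  have h : (⊥ : Subfield ℂ) ≤ (Rat.castHom ℂ).fieldRange := bot_le
  obtain ⟨q, hq⟩ := RingHom.mem_fieldRange.1 (h hy)
  exact ⟨q, hq⟩

/-- A set defined over the prime field `⊥ ≤ ℂ` is the zero set of an ideal of `ℚ[X]`.
[folklore] -/
theorem exists_ideal_rat_of_isDefinedOver_bot {ι : Type*} {W : Set (ι → ℂ)}
    (hW : IsDefinedOver (⊥ : Subfield ℂ) W) :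
    ∃ J : Ideal (MvPolynomial ι ℚ), W = zeroLocus ℂ J := by
  obtain ⟨I, rfl⟩ := hW
  let k : Subfield ℂ := ⊥
  -- the isomorphism `ℚ ≃ k`
  have hsurj : Function.Surjective (algebraMap ℚ k) := by
    intro y
    obtain ⟨q, hq⟩ := exists_rat_eq_of_mem_bot y.2
    refine ⟨q, Subtype.ext ?_⟩
    rw [← hq]
    exact SubfieldClass.coe_ratCast k q
  let e : ℚ ≃+* k := RingEquiv.ofBijective (algebraMap ℚ k) ⟨(algebraMap ℚ k).injective, hsurj⟩
  have he : ∀ y : k, ((e.symm y : ℚ) : ℂ) = (y : ℂ) := by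
    intro y
    have h1 : e (e.symm y) = y := e.apply_symm_apply y
    have h2 : (e (e.symm y) : ℂ) = ((e.symm y : ℚ) : ℂ) := SubfieldClass.coe_ratCast k _
    rw [← h2, h1]
  refine ⟨I.map (MvPolynomial.map (e.symm : k →+* ℚ)), ?_⟩
  have hmap : ∀ p : MvPolynomial ι k, ∀ x : ι → ℂ,
      aeval x (MvPolynomial.map (e.symm : k →+* ℚ) p) = aeval x p := by
    intro p x
    rw [aeval_def, eval₂_map, aeval_def]
    congr 1
    ext y
    simp only [RingHom.coe_comp, Function.comp_apply]
    rw [eq_ratCast]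
    exact he y
  ext x
  simp only [mem_zeroLocus_iff]
  constructor
  · intro hx q hq
    rw [Ideal.mem_map_iff_of_surjective _
      (MvPolynomial.map_surjective _ e.symm.surjective)] at hq
    obtain ⟨p, hp, rfl⟩ := hq
    rw [hmap]
    exact hx p hp
  · intro hx p hp
    rw [← hmap]
    exact hx _ (Ideal.mem_map_of_mem _ hp)

/-- `dim W < 2` for `W = Z_ℂ(J)` means `dim ℂ[X] ⧸ I(Z(J)) ≤ 1`. [folklore] -/
theorem ringKrullDim_le_one_of_zariskiDim_lt_two {ι : Type*} {W : Set (ι → ℂ)}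
    (hdim : zariskiDim ℂ W < 2) {J : Ideal (MvPolynomial ι ℚ)} (hWJ : W = zeroLocus ℂ J) :
    ringKrullDim (MvPolynomial ι ℂ ⧸ vanishingIdeal ℂ (zeroLocus ℂ J)) ≤ 1 := by
  rw [← hWJ]
  change zariskiDim ℂ W ≤ 1
  induction h : zariskiDim ℂ W using WithBot.recBotCoe with
  | bot => exact bot_le
  | coe n =>
    rw [h] at hdim
    have h' : n < 2 := WithBot.coe_lt_coe.1 hdim
    exact WithBot.coe_le_coe.2 (Order.le_of_lt_succ h')

/-! ### Graph points -/

/-- The graph point `(x, eˣ) ∈ ℂ² × ℂ²` of `x ∈ ℂ²`. [folklore] -/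
theorem graph_injective :
    Function.Injective (fun x : Fin 2 → ℂ => Sum.elim x (Complex.exp ∘ x)) := by
  intro x y hxy
  funext j
  have := congrFun hxy (Sum.inl j)
  simpa using this

/-! ### Constants of a component of `W` which are `ℚ`-rational functions are algebraic -/

section Component

variable {J : Ideal (MvPolynomial (Fin 2 ⊕ Fin 2) ℚ)}
  (hdim : ringKrullDim (MvPolynomial (Fin 2 ⊕ Fin 2) ℂ ⧸
    vanishingIdeal ℂ (zeroLocus ℂ J)) ≤ 1)
  {P : Ideal (MvPolynomial (Fin 2 ⊕ Fin 2) ℂ)} [hP : P.IsPrime]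
  (hJP : ∀ f ∈ J, MvPolynomial.map (algebraMap ℚ ℂ) f ∈ P)

include hdim hJP

/-- **Transcendental constants force a point.** Let `P` be a non-maximal prime of `ℂ[X, Y]`
containing (the image of) `J`, `dim Z_ℂ(J) ≤ 1`. If `t · g ≡ f (mod P)` for `f, g ∈ ℚ[X, Y]` with
`g ∉ P`, then `t` is algebraic over `ℚ` (applied to the generic point of `Z(P)`:
`mem_range_algebraMap_of_transcendental` and `isMaximal_of_forall_X_sub_C_mem`).
[cite: GortzWedhorn2020, Prop. 5.38] -/
theorem isAlgebraic_of_rel_mem (hPmax : ¬ P.IsMaximal) (t : ℂ) (f g : MvPolynomial (Fin 2 ⊕ Fin 2) ℚ)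
    (hg : MvPolynomial.map (algebraMap ℚ ℂ) g ∉ P)
    (hrel : C t * MvPolynomial.map (algebraMap ℚ ℂ) g - MvPolynomial.map (algebraMap ℚ ℂ) f ∈ P) :
    IsAlgebraic ℚ t := by
  by_contra ht
  have hζJ : ∀ f ∈ J, aeval (genericPt P) f = 0 := by
    intro f hf
    rw [← aeval_map_algebraMap ℂ, aeval_genericPt_eq_zero_iff]
    exact hJP f hf
  have hgζ : aeval (genericPt P) g ≠ 0 := by
    rw [← aeval_map_algebraMap ℂ, Ne, aeval_genericPt_eq_zero_iff]
    exact hg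
  have hrelζ : algebraMap ℂ (zeroLocusFunctionField P) t * aeval (genericPt P) g =
      aeval (genericPt P) f := by
    have := (aeval_genericPt_eq_zero_iff P _).2 hrel
    rw [map_sub, map_mul, aeval_C, aeval_map_algebraMap, aeval_map_algebraMap, sub_eq_zero] at this
    exact this
  have hrange := mem_range_algebraMap_of_transcendental (F := ℂ) J hdim (genericPt P) hζJ ht f g
    hgζ hrelζ
  choose lam hlam using hrange
  apply hPmax
  refine isMaximal_of_forall_X_sub_C_mem lam fun i => ?_
  rw [← aeval_genericPt_eq_zero_iff, map_sub, aeval_X, aeval_C, ← hlam i, sub_self]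

/-- **Two coordinates of a component of `W` are algebraically dependent over `ℚ`**: there is a
non-zero `R ∈ ℚ[z, w]` with `R(X (e 0), X (e 1)) ∈ P`, for any choice `e` of two coordinates.
[cite: GortzWedhorn2020, Prop. 5.38] -/
theorem exists_rat_poly_rename_mem (e : Fin 2 → Fin 2 ⊕ Fin 2) :
    ∃ R : MvPolynomial (Fin 2) ℚ, R ≠ 0 ∧
      rename e (MvPolynomial.map (algebraMap ℚ ℂ) R) ∈ P := by
  have hζJ : ∀ f ∈ J, aeval (genericPt P) f = 0 := by
    intro f hf
    rw [← aeval_map_algebraMap ℂ, aeval_genericPt_eq_zero_iff]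
    exact hJP f hf
  have hdep := not_algebraicIndependent_pair_of_aeval_eq_zero (F := ℂ) J hdim (genericPt P) hζJ
    (fun j => X (e j))
  rw [algebraicIndependent_iff] at hdep
  push Not at hdep
  obtain ⟨R, hR0, hRne⟩ := hdep
  refine ⟨R, hRne, ?_⟩
  rw [← aeval_genericPt_eq_zero_iff, aeval_rename, aeval_map_algebraMap]
  have : (genericPt P ∘ e) =
      fun j => aeval (genericPt P) (X (e j) : MvPolynomial (Fin 2 ⊕ Fin 2) ℚ) := by
    funext j
    simp
  rw [this]
  exact hR0

end Component

/-! ### Degenerate sections -/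

/-- The monomial relation on the graph: `(e^{x₀})^{a⁺} (e^{x₁})^{b⁺} = e^{a x₀ + b x₁} (e^{x₀})^{a⁻} (e^{x₁})^{b⁻}`
with `a = a⁺ - a⁻`, `b = b⁺ - b⁻` the decompositions into natural numbers. [folklore] -/
theorem exp_monomial_identity (a b : ℤ) (x : Fin 2 → ℂ) :
    Complex.exp (x 0) ^ a.toNat * Complex.exp (x 1) ^ b.toNat =
      Complex.exp ((a : ℂ) * x 0 + (b : ℂ) * x 1) *
        (Complex.exp (x 0) ^ (-a).toNat * Complex.exp (x 1) ^ (-b).toNat) := by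
  rw [← Complex.exp_nat_mul, ← Complex.exp_nat_mul, ← Complex.exp_nat_mul, ← Complex.exp_nat_mul,
    ← Complex.exp_add, ← Complex.exp_add, ← Complex.exp_add]
  congr 1
  have ha : ((a.toNat : ℕ) : ℂ) = (a : ℂ) + (((-a).toNat : ℕ) : ℂ) := by
    have := Int.toNat_sub_toNat_neg a
    have h2 : ((a.toNat : ℤ) : ℂ) = (a : ℂ) + (((-a).toNat : ℤ) : ℂ) := by
      rw [← Int.cast_add]; congr 1; omega
    exact_mod_cast h2
  have hb : ((b.toNat : ℕ) : ℂ) = (b : ℂ) + (((-b).toNat : ℕ) : ℂ) := by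
    have h2 : ((b.toNat : ℤ) : ℂ) = (b : ℂ) + (((-b).toNat : ℤ) : ℂ) := by
      rw [← Int.cast_add]; congr 1; omega
    exact_mod_cast h2
  rw [ha, hb]
  ring

/-- **Degenerate sections carry finitely many independent exponential points.** For
`W ⊆ ℂ² × ℂ²` defined over `ℚ` with `dim W < 2`, `(a, b) ∈ ℤ² ∖ 0` and any `c ∈ ℂ`, the set of
`x ∈ indepExpPoints W` with `a x₀ + b x₁ = c` is finite. (Hermite–Lindemann: on a curve
component the constants `c` and `e^c = y₀^a y₁^b` are `ℚ`-rational functions, hence algebraic,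
so `c = 0`, contradicting independence.) [cite: Lindemann1882] -/
theorem finite_indepExpPoints_section (W : Set (Fin 2 ⊕ Fin 2 → ℂ))
    (hW : IsDefinedOver (⊥ : Subfield ℂ) W) (hdim : zariskiDim ℂ W < 2)
    (a b : ℤ) (hab : a ≠ 0 ∨ b ≠ 0) (c : ℂ) :
    Set.Finite {x : Fin 2 → ℂ | x ∈ indepExpPoints W ∧ (a : ℂ) * x 0 + (b : ℂ) * x 1 = c} := by
  by_contra hinf
  rw [← Set.not_infinite, not_not] at hinf
  obtain ⟨J, hWJ⟩ := exists_ideal_rat_of_isDefinedOver_bot hW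
  have hdim1 := ringKrullDim_le_one_of_zariskiDim_lt_two hdim hWJ
  set Hx := {x : Fin 2 → ℂ | x ∈ indepExpPoints W ∧ (a : ℂ) * x 0 + (b : ℂ) * x 1 = c} with hHx
  set graph : (Fin 2 → ℂ) → (Fin 2 ⊕ Fin 2 → ℂ) := fun x => Sum.elim x (Complex.exp ∘ x)
    with hgraph
  set H : Set (Fin 2 ⊕ Fin 2 → ℂ) := graph '' Hx with hH
  have hHinf : H.Infinite := hinf.image graph_injective.injOn
  obtain ⟨P, hPprime, hIP, hPmax, hPinf⟩ := exists_prime_infinite_inter_zeroLocus hHinf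
  -- what vanishes on `H`
  have hHW : ∀ z ∈ H, z ∈ W := by
    rintro z ⟨x, hx, rfl⟩
    exact hx.1.2
  have hJP : ∀ f ∈ J, MvPolynomial.map (algebraMap ℚ ℂ) f ∈ P := by
    intro f hf
    refine hIP ((mem_vanishingIdeal_iff).2 fun z hz => ?_)
    rw [aeval_map_algebraMap]
    have hzW := hHW z hz
    rw [hWJ] at hzW
    exact (mem_zeroLocus_iff.1 hzW) f hf
  -- the linear form
  set Lf : MvPolynomial (Fin 2 ⊕ Fin 2) ℚ := C (a : ℚ) * X (Sum.inl 0) + C (b : ℚ) * X (Sum.inl 1)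
    with hLf
  have hLval : ∀ x : Fin 2 → ℂ, aeval (graph x) (MvPolynomial.map (algebraMap ℚ ℂ) Lf) =
      (a : ℂ) * x 0 + (b : ℂ) * x 1 := by
    intro x
    rw [aeval_map_algebraMap]
    simp [hLf, hgraph]
  have hcalg : IsAlgebraic ℚ c := by
    refine isAlgebraic_of_rel_mem hdim1 hJP hPmax c Lf 1 ?_ ?_
    · rw [map_one]
      exact (Ideal.ne_top_iff_one P).1 hPprime.ne_top
    · refine hIP ((mem_vanishingIdeal_iff).2 ?_)
      rintro z ⟨x, hx, rfl⟩
      simp only [map_sub, map_one, aeval_C, hLval, Algebra.algebraMap_self,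
        RingHom.id_apply, mul_one, hx.2, sub_self]
  -- the monomial: `Y₀, Y₁ ∉ P`
  obtain ⟨z₀, hz₀⟩ := hPinf.nonempty
  have hY : ∀ j : Fin 2, (X (Sum.inr j) : MvPolynomial (Fin 2 ⊕ Fin 2) ℂ) ∉ P := by
    intro j hXj
    obtain ⟨⟨x, hx, rfl⟩, hzP⟩ := hz₀
    have := (mem_zeroLocus_iff.1 hzP) _ hXj
    simp [hgraph] at this
  set g : MvPolynomial (Fin 2 ⊕ Fin 2) ℚ := X (Sum.inr 0) ^ (-a).toNat * X (Sum.inr 1) ^ (-b).toNat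
    with hg
  set f : MvPolynomial (Fin 2 ⊕ Fin 2) ℚ := X (Sum.inr 0) ^ a.toNat * X (Sum.inr 1) ^ b.toNat
    with hf
  have hgP : MvPolynomial.map (algebraMap ℚ ℂ) g ∉ P := by
    rw [hg, map_mul, map_pow, map_pow, map_X, map_X]
    intro h
    rcases hPprime.mem_or_mem h with h0 | h1
    · exact hY 0 (hPprime.mem_of_pow_mem _ h0)
    · exact hY 1 (hPprime.mem_of_pow_mem _ h1)
  have hexpalg : IsAlgebraic ℚ (Complex.exp c) := by
    refine isAlgebraic_of_rel_mem hdim1 hJP hPmax _ f g hgP ?_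
    refine hIP ((mem_vanishingIdeal_iff).2 ?_)
    rintro z ⟨x, hx, rfl⟩
    simp only [map_sub, map_mul, aeval_C, aeval_map_algebraMap, hf, hg, map_pow, aeval_X, hgraph,
      Sum.elim_inr, Function.comp_apply, Algebra.algebraMap_self, RingHom.id_apply]
    rw [exp_monomial_identity a b x, hx.2, sub_self]
  -- Hermite–Lindemann
  have hc0 : c = 0 := by
    by_contra hc
    exact transcendental_exp_holds hcalg hc hexpalg
  -- contradiction with independence of a point of `H ∩ Z(P)`
  obtain ⟨⟨x, hx, rfl⟩, -⟩ := hz₀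
  have hli : LinearIndependent ℚ x := hx.1.1
  have hrel : (a : ℂ) * x 0 + (b : ℂ) * x 1 = 0 := hc0 ▸ hx.2
  have hx2 : x = ![x 0, x 1] := by
    ext j; fin_cases j <;> rfl
  rw [hx2, LinearIndependent.pair_iff] at hli
  have := hli (a : ℚ) (b : ℚ) (by
    rw [Rat.smul_def, Rat.smul_def]
    push_cast
    exact hrel)
  rcases hab with ha | hb
  · exact ha (by exact_mod_cast this.1)
  · exact hb (by exact_mod_cast this.2)

end Literature.NumberTheory.Transcendental
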